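import Literature.Barriers.CriticalPhenomena.TimarHeavySlabs
import Literature.Barriers.CriticalPhenomena.TimarTargetForest
import HarnessLib

/-!
# Timár 2006, §5: heavy branches and encounter points; a heavy branch meets every slab in
# infinitely many vertices (the input of Lemma 5.3 from Lemma 5.2) — PROVED

Barrier catalogue `Literature/Barriers/CriticalPhenomena/`; a brick of the programme proving
Timár's Thm. 5.5 (`Timar2006_finiteLevelUnion`, `TimarCriticalNonunimodular.lean`). Á. Timár,
*Percolation on nonunimodular transitive graphs*, Ann. Probab. 34 (2006) 2344–2364, §5, p. 2357:

> "We call a vertex `x` in a connected graph `C` an *encounter point* if `C ∖ x` has at least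
> three heavy infinite connected components. … **Lemma 5.3.** … for any encounter point
> `x ∈ L₀ ∩ ω` and any open heavy component `C` in `ω ∖ {x}` that is adjacent to `x` in `ω`,
> `C ∩ L₀` contains some vertex that is an encounter point for `ω`. *Proof.* … Since `C ∩ L₀` is
> infinite (by deletion tolerance and Lemma 5.2), the expected mass received is infinite."

This file fixes the vocabulary and proves the parenthetical input "(by deletion tolerance and
Lemma 5.2)":

* `branchSet ω x u` — the component of `u` in the open graph with the vertex `x` deleted
  (reachability avoiding `x`, `AvoidReach` of `TimarTargetForest.lean`); for `ω ⊆ E(G)` and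
  `u ≠ x` it is the open cluster of `u` after closing the edges at `x`
  (`branchSet_eq_openCluster_closeEdges`);
* `IsEncounter G o ω x` — `x` has three vertices of its cluster in pairwise different branches
  at `x`, each branch heavy ("at least three heavy … components" of `C ∖ x`);
* invariance under automorphisms (`avoidReach_relabel_iff`, `isEncounter_relabel_iff`) and
  measurability (`measurableSet_isEncounter`);
* `ae_infinite_branchSet_inter_weightSlab` — **for `0 < p < 1` and every slab `L` of width
  `a ≤ Δ b` (`0 < b < ∞`), almost surely every heavy branch at every vertex meets `L` in
  infinitely many vertices**: closing the edges at `x` (deletion tolerance) turns the branch into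
  a heavy cluster meeting `L` finitely often, a null event by Lemma 5.2
  (`ae_infinite_inter_weightSlab`, `TimarHeavySlabs.lean`).

## References

* Á. Timár, Ann. Probab. 34 (2006) 2344–2364 (arXiv:math/0702875), §5: encounter points,
  Lemma 5.3 and its proof. [Timar2006]
* R. Lyons, Y. Peres, *Probability on Trees and Networks*, CUP 2016, §7.3 (furcations /
  encounter points, footnote to the proof of Thm. 7.6). [LyonsPeres2016]
-/

noncomputable section

namespace Literature.Barriers.CriticalPhenomena

open _root_.MeasureTheory _root_.ProbabilityTheory
  Literature.Probability.LatticeModels Literature.Probability.Percolation SimpleGraph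
open scoped ENNReal

variable {V : Type*}

/-! ### Branches at a vertex -/

/-- The **branch of `u` at `x`** in the configuration `ω`: the vertices joined to `u` by an open
walk avoiding `x` (a component of "`C ∖ x`"; empty if `u = x`).
[cite: Timar2006, §5 (encounter points: components of C ∖ x)] -/
def branchSet (ω : BondConfig V) (x u : V) : Set V :=
  {z | AvoidReach (openGraph ω) x u z}

/-- The pairs containing `x` (all possible edges at `x`). [folklore] -/
def pairsAt (x : V) : Set (Sym2 V) := {e | x ∈ e}

/-- Membership in `pairsAt`. [folklore] -/
@[simp] theorem mem_pairsAt {x : V} {e : Sym2 V} : e ∈ pairsAt x ↔ x ∈ e := Iff.rfl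

/-- **Avoiding `x` = reachability after closing all pairs at `x`** (for `u ≠ x`). [folklore] -/
theorem avoidReach_iff_reachable_closeEdges {ω : BondConfig V} {x u z : V} (hu : u ≠ x) :
    AvoidReach (openGraph ω) x u z ↔ (openGraph (closeEdges (pairsAt x) ω)).Reachable u z := by
  constructor
  · rintro ⟨p, hp⟩
    -- every edge of `p` avoids `x`, so `p` transfers
    induction p with
    | nil => exact Reachable.refl _
    | @cons a b c hadj q ih =>
      rw [Walk.support_cons, List.mem_cons, not_or] at hp
      have hbx : b ≠ x := fun h => hp.2 (h ▸ q.start_mem_support)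
      have hadj' : (openGraph (closeEdges (pairsAt x) ω)).Adj a b := by
        rw [openGraph_adj] at hadj ⊢
        refine ⟨?_, hadj.2⟩
        rw [mem_closeEdges, mem_pairsAt, Sym2.mem_iff, not_or]
        exact ⟨hadj.1, hp.1, Ne.symm hbx⟩
      exact (Adj.reachable hadj').trans (ih hbx hp.2)
  · rintro ⟨p⟩
    -- a walk of the pruned graph never visits `x` (all pairs at `x` are closed)
    have key : ∀ {a b : V} (q : (openGraph (closeEdges (pairsAt x) ω)).Walk a b), a ≠ x →
        ∃ q' : (openGraph ω).Walk a b, x ∉ q'.support := by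
      intro a b q
      induction q with
      | nil => intro ha; exact ⟨Walk.nil, by simpa using Ne.symm ha⟩
      | @cons a b c hadj q ih =>
        intro ha
        rw [openGraph_adj, mem_closeEdges, mem_pairsAt, Sym2.mem_iff, not_or] at hadj
        obtain ⟨q', hq'⟩ := ih (Ne.symm hadj.1.2.2)
        refine ⟨Walk.cons ((openGraph_adj ω a b).2 ⟨hadj.1.1, hadj.2⟩) q', ?_⟩
        rw [Walk.support_cons, List.mem_cons, not_or]
        exact ⟨Ne.symm ha |>.symm |> Ne.symm, hq'⟩
    exact key p hu

/-- For `ω ⊆ E(G)` closing the pairs at `x` or the edges of `G` at `x` is the same. [folklore] -/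
theorem closeEdges_pairsAt_eq [DecidableEq V] {G : SimpleGraph V} [G.LocallyFinite]
    {ω : BondConfig V} (hω : ω ⊆ G.edgeSet) (x : V) :
    closeEdges (pairsAt x) ω = closeEdges ↑(edgesAt G {x}) ω := by
  ext e
  simp only [mem_closeEdges, mem_pairsAt, Finset.mem_coe, mem_edgesAt, Finset.mem_singleton,
    exists_eq_left]
  constructor
  · rintro ⟨he, hx⟩
    exact ⟨he, fun h => hx h.2⟩
  · rintro ⟨he, hx⟩
    exact ⟨he, fun h => hx ⟨hω he, h⟩⟩

/-- **The branch is the cluster after closing the edges at `x`** (`ω ⊆ E(G)`, `u ≠ x`).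
[cite: Timar2006, §5 (proof of Lemma 5.3: deletion tolerance)] -/
theorem branchSet_eq_openCluster_closeEdges [DecidableEq V] {G : SimpleGraph V} [G.LocallyFinite]
    {ω : BondConfig V} (hω : ω ⊆ G.edgeSet) {x u : V} (hu : u ≠ x) :
    branchSet ω x u = openCluster (closeEdges ↑(edgesAt G {x}) ω) u := by
  ext z
  rw [branchSet, Set.mem_setOf_eq, avoidReach_iff_reachable_closeEdges hu, closeEdges_pairsAt_eq hω]
  rfl

/-- The branch of `u ≠ x` is the cluster of `u` for the configuration with all pairs at `x`
closed (no hypothesis on `ω`). [folklore] -/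
theorem branchSet_eq_openCluster_closeEdges_pairsAt {ω : BondConfig V} {x u : V} (hu : u ≠ x) :
    branchSet ω x u = openCluster (closeEdges (pairsAt x) ω) u := by
  ext z
  rw [branchSet, Set.mem_setOf_eq, avoidReach_iff_reachable_closeEdges hu]
  rfl

/-- The branch at `x` of `x` itself is empty. [folklore] -/
theorem branchSet_self (ω : BondConfig V) (x : V) : branchSet ω x x = ∅ :=
  Set.eq_empty_of_forall_notMem fun _ h => h.ne_left rfl

/-- A branch lies in the cluster with `x` removed; in particular in the cluster. [folklore] -/
theorem branchSet_subset_openCluster (ω : BondConfig V) (x u : V) : branchSet ω x u ⊆ openCluster ω u :=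
  fun _ h => h.reachable

/-! ### Encounter points -/

/-- **`x` is an encounter point** of the configuration `ω`: there are three vertices of the
cluster of `x` lying in pairwise different branches at `x`, each branch heavy ("`C ∖ x` has at
least three heavy infinite connected components", Timár 2006, §5; Burton–Keane's encounter
points / Lyons–Peres's furcations with "infinite" replaced by "heavy").
[cite: Timar2006, §5 (definition of an encounter point)] -/
def IsEncounter (G : SimpleGraph V) (o : V) (ω : BondConfig V) (x : V) : Prop :=
  ∃ u : Fin 3 → V, (∀ i, u i ∈ openCluster ω x) ∧
    (∀ i j, AvoidReach (openGraph ω) x (u i) (u j) → i = j) ∧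
    ∀ i, IsHeavy G o (branchSet ω x (u i))

/-! ### Invariance under automorphisms -/

/-- Avoiding reachability is transported along graph isomorphisms. [folklore] -/
theorem AvoidReach.map_iso {W : Type*} {Γ : SimpleGraph V} {Γ' : SimpleGraph W} (φ : Γ ≃g Γ')
    {x u z : V} (h : AvoidReach Γ x u z) : AvoidReach Γ' (φ x) (φ u) (φ z) := by
  obtain ⟨p, hp⟩ := h
  refine ⟨p.map φ.toHom, ?_⟩
  rw [Walk.support_map, List.mem_map]
  rintro ⟨y, hy, hyx⟩
  exact hp (φ.injective hyx ▸ hy)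

/-- Avoiding reachability is transported by relabelling. [folklore] -/
theorem avoidReach_relabel_iff (e : V ≃ V) (ω : BondConfig V) (x u z : V) :
    AvoidReach (openGraph (BondConfig.relabel (sym2Equiv e) ω)) (e x) (e u) (e z) ↔
      AvoidReach (openGraph ω) x u z := by
  constructor
  · intro h
    have h' := h.map_iso (openGraphRelabelIso e ω).symm
    change AvoidReach (openGraph ω) (e.symm (e x)) (e.symm (e u)) (e.symm (e z)) at h'
    simpa only [Equiv.symm_apply_apply] using h'
  · intro h
    exact h.map_iso (openGraphRelabelIso e ω)

/-- Branches are transported by relabelling. [folklore] -/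
theorem branchSet_relabel (e : V ≃ V) (ω : BondConfig V) (x u : V) :
    branchSet (BondConfig.relabel (sym2Equiv e) ω) (e x) (e u) = e '' branchSet ω x u := by
  ext z
  rw [branchSet, Set.mem_setOf_eq, Set.mem_image]
  constructor
  · intro h
    refine ⟨e.symm z, ?_, e.apply_symm_apply z⟩
    rw [branchSet, Set.mem_setOf_eq, ← avoidReach_relabel_iff e, e.apply_symm_apply]
    exact h
  · rintro ⟨y, hy, rfl⟩
    exact (avoidReach_relabel_iff e ω x u y).2 hy

/-- **Encounter points are transported by automorphisms.** [folklore] -/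
theorem isEncounter_relabel_iff (G : SimpleGraph V) [G.LocallyFinite] (hconn : G.Connected)
    (γ : G ≃g G) (o : V) (ω : BondConfig V) (x : V) :
    IsEncounter G o (BondConfig.relabel (sym2Equiv γ.toEquiv) ω) (γ x) ↔ IsEncounter G o ω x := by
  constructor
  · rintro ⟨u, hu, hsep, hheavy⟩
    refine ⟨fun i => γ.symm (u i), fun i => ?_, fun i j h => hsep i j ?_, fun i => ?_⟩
    · have := hu i
      rw [← γ.toEquiv.apply_symm_apply (u i)] at this
      exact (reachable_relabel_iff γ.toEquiv ω x _).1 this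
    · have := (avoidReach_relabel_iff γ.toEquiv ω x (γ.symm (u i)) (γ.symm (u j))).2 h
      simpa using this
    · have h := hheavy i
      rw [← γ.toEquiv.apply_symm_apply (u i)] at h
      change IsHeavy G o (branchSet _ (γ.toEquiv x) (γ.toEquiv (γ.toEquiv.symm (u i)))) at h
      rw [branchSet_relabel γ.toEquiv ω x] at h
      exact (isHeavy_image_iff G hconn γ o _).1 h
  · rintro ⟨u, hu, hsep, hheavy⟩
    refine ⟨fun i => γ (u i), fun i => (reachable_relabel_iff γ.toEquiv ω x (u i)).2 (hu i),
      fun i j h => hsep i j ((avoidReach_relabel_iff γ.toEquiv ω x (u i) (u j)).1 h), fun i => ?_⟩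
    change IsHeavy G o (branchSet _ (γ.toEquiv x) (γ.toEquiv (u i)))
    rw [branchSet_relabel γ.toEquiv ω x (u i)]
    exact (isHeavy_image_iff G hconn γ o _).2 (hheavy i)

/-! ### Measurability -/

section Measurability

variable [Countable V]

/-- Avoiding reachability is a measurable event. [folklore] -/
theorem measurableSet_avoidReach (x u z : V) :
    MeasurableSet {ω : BondConfig V | AvoidReach (openGraph ω) x u z} := by
  by_cases hu : u = x
  · have : {ω : BondConfig V | AvoidReach (openGraph ω) x u z} = ∅ :=
      Set.eq_empty_of_forall_notMem fun ω h => h.ne_left hu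
    rw [this]
    exact MeasurableSet.empty
  · simp_rw [avoidReach_iff_reachable_closeEdges hu]
    exact measurableSet_reachable_comp (measurable_closeEdges _) u z

/-- Heaviness of a branch is a measurable event. [folklore] -/
theorem measurableSet_isHeavy_branchSet (G : SimpleGraph V) (o x u : V) :
    MeasurableSet {ω : BondConfig V | IsHeavy G o (branchSet ω x u)} := by
  by_cases hu : u = x
  · subst hu
    simp_rw [branchSet_self]
    exact MeasurableSet.const _
  · simp_rw [branchSet_eq_openCluster_closeEdges_pairsAt hu]
    exact measurableSet_isHeavy_openCluster_comp (measurable_closeEdges _) G o u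

/-- **`{x is an encounter point}` is measurable** (`V` countable). [folklore] -/
theorem measurableSet_isEncounter (G : SimpleGraph V) (o x : V) :
    MeasurableSet {ω : BondConfig V | IsEncounter G o ω x} := by
  have hrepr : {ω : BondConfig V | IsEncounter G o ω x} =
      ⋃ u : Fin 3 → V, ((⋂ i, {ω | (openGraph ω).Reachable x (u i)}) ∩
        ((⋂ i, ⋂ j, ({ω | AvoidReach (openGraph ω) x (u i) (u j)}ᶜ ∪ {_ω | i = j})) ∩
          ⋂ i, {ω | IsHeavy G o (branchSet ω x (u i))})) := by
    ext ω
    simp only [IsEncounter, openCluster, Set.mem_setOf_eq, Set.mem_iUnion, Set.mem_inter_iff,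
      Set.mem_iInter, Set.mem_union, Set.mem_compl_iff]
    refine exists_congr fun u => and_congr_right fun _ => and_congr_left fun _ => ?_
    refine forall_congr' fun i => forall_congr' fun j => ?_
    exact ⟨fun h => (em (AvoidReach (openGraph ω) x (u i) (u j))).elim (fun ha => Or.inr (h ha)) Or.inl,
      fun h ha => h.elim (fun hn => absurd ha hn) id⟩
  rw [hrepr]
  refine MeasurableSet.iUnion fun u => ?_
  refine (MeasurableSet.iInter fun i => measurableSet_openConn_holds x (u i)).inter
    ((MeasurableSet.iInter fun i => MeasurableSet.iInter fun j => ?_).inter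
      (MeasurableSet.iInter fun i => measurableSet_isHeavy_branchSet G o x (u i)))
  exact (measurableSet_avoidReach x (u i) (u j)).compl.union (MeasurableSet.const _)

end Measurability

/-! ### "By deletion tolerance and Lemma 5.2": heavy branches meet every slab infinitely often -/

section Slab

variable [Countable V] {G : SimpleGraph V} [G.LocallyFinite]

/-- The event "`C(u)` meets the set `L` in finitely many vertices" is measurable (a countable
union over the possible finite intersections). [folklore] -/
theorem measurableSet_finite_openCluster_inter (u : V) (L : Set V) :
    MeasurableSet {ω : BondConfig V | (openCluster ω u ∩ L).Finite} := by
  have h : {ω : BondConfig V | (openCluster ω u ∩ L).Finite} =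
      ⋃ K : Finset V, ⋂ y : V, {ω | y ∈ L → (openGraph ω).Reachable u y → y ∈ K} := by
    ext ω
    simp only [Set.mem_setOf_eq, Set.mem_iUnion, Set.mem_iInter]
    constructor
    · intro hfin
      refine ⟨hfin.toFinset, fun y hyL hy => ?_⟩
      exact hfin.mem_toFinset.2 ⟨hy, hyL⟩
    · rintro ⟨K, hK⟩
      exact K.finite_toSet.subset fun y ⟨hy, hyL⟩ => hK y hyL hy
  rw [h]
  refine MeasurableSet.iUnion fun K => MeasurableSet.iInter fun y => ?_
  by_cases hyL : y ∈ L
  · by_cases hyK : y ∈ K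
    · have : {ω : BondConfig V | y ∈ L → (openGraph ω).Reachable u y → y ∈ K} = Set.univ :=
        Set.eq_univ_of_forall fun _ _ _ => hyK
      rw [this]; exact MeasurableSet.univ
    · have : {ω : BondConfig V | y ∈ L → (openGraph ω).Reachable u y → y ∈ K} =
          {ω | (openGraph ω).Reachable u y}ᶜ := by
        ext ω; simp [hyL, hyK]
      rw [this]; exact (measurableSet_openConn_holds u y).compl
  · have : {ω : BondConfig V | y ∈ L → (openGraph ω).Reachable u y → y ∈ K} = Set.univ :=
      Set.eq_univ_of_forall fun _ h => absurd h hyL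
    rw [this]; exact MeasurableSet.univ

/-- **A heavy branch meets every slab in infinitely many vertices** ("`C ∩ L₀` is infinite (by
deletion tolerance and Lemma 5.2)", Timár 2006, proof of Lemma 5.3): on a connected, locally
finite, transitive nonunimodular graph, for `0 < p < 1` and a slab `L = {a < w ≤ b}` with
`a ≤ Δ b`, `0 < b < ∞`, almost surely, for every vertex `x` and every `u`, if the branch of `u`
at `x` is heavy then it meets `L` in infinitely many vertices.
[cite: Timar2006, Lemma 5.3 (proof: "C ∩ L₀ is infinite, by deletion tolerance and Lemma 5.2")] -/
theorem ae_infinite_branchSet_inter_weightSlab (hconn : G.Connected) (ht : IsGraphTransitive G)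
    (hU : ¬ IsGraphUnimodular G) {p : unitInterval} (hp0 : 0 < (p : ℝ)) (hp1 : (p : ℝ) < 1) (o : V)
    {a b : ℝ≥0∞} (hab : a ≤ minNbrWeight G o * b) (hb0 : b ≠ 0) (hbT : b ≠ ⊤) :
    ∀ᵐ ω ∂(bondPercolation G p), ∀ x u, IsHeavy G o (branchSet ω x u) →
      (branchSet ω x u ∩ weightSlab G o a b).Infinite := by
  classical
  set μ := bondPercolation G p with hμ
  set L := weightSlab G o a b with hL
  -- the null event of Lemma 5.2 at `u`
  set E : V → Set (BondConfig V) := fun u =>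
    {ω | IsHeavy G o (openCluster ω u) ∧ (openCluster ω u ∩ L).Finite} with hE
  have hEnull : ∀ u, μ (E u) = 0 := by
    intro u
    refine measure_mono_null ?_
      (ae_iff.1 (ae_infinite_inter_weightSlab hconn ht hU hp0 hp1 o hab hb0 hbT))
    intro ω hω hall
    exact (hall u hω.1) hω.2
  have hEm : ∀ u, MeasurableSet (E u) := fun u =>
    (measurableSet_isHeavy_openCluster G o u).inter (measurableSet_finite_openCluster_inter u L)
  rw [ae_all_iff]; intro x
  rw [ae_all_iff]; intro u
  by_cases hux : u = x
  · subst hux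
    filter_upwards with ω hH
    rw [branchSet_self] at hH
    exact absurd hH (not_isHeavy_of_finite G hconn o Set.finite_empty)
  set A := {ω : BondConfig V | IsHeavy G o (branchSet ω x u) ∧ (branchSet ω x u ∩ L).Finite} with hA
  suffices hA0 : μ A = 0 by
    filter_upwards [measure_eq_zero_iff_ae_notMem.1 hA0] with ω hω hH
    by_contra hfin
    exact hω ⟨hH, Set.not_infinite.1 hfin⟩
  by_contra hne
  -- deletion tolerance: closing the edges at `x` turns `A` into `E u`
  have hpos : 0 < μ.real (E u) := by
    refine bondPercolation_real_pos_of_closeEdges G hp1 (edgesAt G {x}) (hEm u)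
      (ENNReal.toReal_pos (measure_inter_ne_zero_of_ae hne setBernoulli_ae_subset) (measure_ne_top _ _))
      ?_
    rintro ω ⟨⟨hH, hfin⟩, hωE⟩
    rw [hE, Set.mem_setOf_eq, ← branchSet_eq_openCluster_closeEdges hωE hux]
    exact ⟨hH, hfin⟩
  rw [measureReal_def, hEnull u, ENNReal.toReal_zero] at hpos
  exact lt_irrefl _ hpos

end Slab

end Literature.Barriers.CriticalPhenomena

end
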